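import Summits.BirchSwinnertonDyer.Rank1Residual.Additive.TameBranchExtraZerosLaw
import HarnessLib

/-!
# THE EXTRA ZEROS' CONTRIBUTION at RANK ZERO — Delbourgo 2002 (B) + the RATIONAL Kato half (C) + a
# tame branch with `B(0) ≠ 0`: `ord Ш[p^∞] + ord Reg_p + ord ∏c + ord ℓ ≤ μ(X) + ord_p[0]⁺_f + c +
# 2 ord #tors` for EVERY rank-zero row, EQUALITY iff `λ(X) = λ_an` (cell `b2b-bsdres`, sub-cell
# additive-p2 = X3♯(G-ord)/X4♯(G-ord), gen 29; part 4)

HONEST FRAMING (cell `b2b-bsdres`, run/shared/lean/b2b/bsd-rank1-residual/, verbatim in every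
file): the goal of the cell is to DELETE the COMBINATION-SHAPED residual classes of the
Birch–Swinnerton-Dyer formula for ALL analytic-rank `≤ 1` elliptic curves over `ℚ` — "full BSD
formula for every rank `≤ 1` curve in class `C`" assembled STRICTLY from published theorems — so
that the rank-`≤ 1` remainder becomes exactly the CONSTRUCTION-SHAPED classes, which are TYPED
(missing-input `Prop`s), NOT attempted. This is not "finishing BSD". Sub-cell additive-p2: the
classes X3♯(G-ord) / X4♯(G-ord) are CONSTRUCTION-SHAPED and stay so; labels / RESIDUAL-MAP marks
UNCHANGED; nothing is booked. Theorems only; the published inputs are hypothesis binders (Delbourgo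
2002 (B) as `LeadingTermClauses W p Dh`, (C) as the typed Kato half `TameBranchRatDvdAt W p`). No
definition, no named fact, no `sorry`.

## What and why

Gen 26 proved the rank-zero valuation identity `ord Ш[p^∞] + ord Reg_p + ord ∏c + ord ℓ = μ(fE) +
2 ord #tors` on the rows with `ord_p[0]⁺_f = −c` (unit plus symbol at `0`; `λ(X) = 0`). Gen 27's census
(E-GAUSSCERT-R0) found nine X4-3 window rows with `p ∣ [0]⁺_f` (`λ_an = 2` ×8, `4` on 7350ca1@5, gen 28
R0X), outside that theorem. The rank-zero twin of part 2: with the rational Kato half `ι g = p^k·B`,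
`g = fE·h`, and the package row `B(0) = α⁻¹·[0]⁺_f ≠ 0` (§6: `g(0) = fE(0)·h(0)`, `ord_p g(0) = k +
ord_p B(0)`, `k ≤ μ(fE) + μ(h) + c`, `μ(h) ≤ ord_p h(0)` with `=` iff `λ(h) = 0`):

* `fE(0) ≠ 0`, so `ord_T fE = 0 = rank` and Delbourgo 2002 (B) clause 2 gives `#Ш[p^∞] < ∞` (and the
  rank-zero Schneider clause), clause 3 `fE(0)·#tors² = u·ℓ·#Ш[p^∞]·Reg_p·∏c`;
* **`ord_p #Ш[p^∞] + ord_p Reg_p(E,Dh) + ord_p ∏c + ord_p ℓ ≤ μ(fE) + ord_p[0]⁺_f + c + 2 ord_p #E(ℚ)_tors`**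
  for EVERY rank-zero row — NO twisted value, unit root, sign or Riemann sum: the analytic side is the ONE
  rational number `[0]⁺_f`;
* if `B` has its FIRST TOP at `n` (the census's two values): `λ(fE) ≤ n` and **EQUALITY iff `λ(fE) = n`**
  (the λ-part of the main conjecture at the pair).

§6 `TameBranchExtraZeros.valuation_constantCoeff_le`; §7 `schneider_and_padicVal_le_rankZero_of_iota_eq`
(per datum); §8 **`schneider_and_padicVal_le_rankZero_of_tameBranchRatDvdAt`** (every defect, (M) included,
ANY tuple). Part 5 (`TameBranchExtraZerosRankZeroCertificate`) supplies the tuple from Delbourgo 1998 Thm 1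
and the first top from two values, type-free. READING: with `μ = 0`, `c = 0`, `ℓ = 1` the inequality is
`ord_p #Ш ≤ ord_p([0]⁺_f·#tors²/∏c)` — the UPPER-half SHAPE at rank zero, modulo `μ` (the rational (C)
cannot see `μ`; an INTEGRAL (C) off defect 2 is not in print). Nothing booked; labels UNCHANGED.

References: Delbourgo 2002 Thm. (A), (B), (C) p. 40 [Delbourgo2002]; Washington GTM 83 §7.1
[Washington1997]; `TwistPartnerTameBranchRankZero.lean` (gen 26), `TameBranchKatoDivisibilityRankOne.lean`
(gen 20), part 1 `TameBranchExtraZerosLaw.lean`. -/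

set_option autoImplicit false

noncomputable section

open scoped Classical MatrixGroups ModularForm NumberField

open CongruenceSubgroup IsDedekindDomain WeierstrassCurve NumberField
  Literature.NumberTheory.EllipticCurves
  Literature.NumberTheory.EllipticCurves.ModularForms
  Literature.NumberTheory.EllipticCurves.Rank1Residual
  Literature.NumberTheory.EllipticCurves.Rank1Residual.Typed
  Literature.NumberTheory.EllipticCurves.Delbourgo2002
  Summit.BirchSwinnertonDyer.Rank1Residual.X1.MuLambda
  Summit.BirchSwinnertonDyer.Rank1Residual.X1.RankOneParitySqueeze
  Summit.BirchSwinnertonDyer.Rank1Residual.X11a.LambdaNorm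

namespace Summit.BirchSwinnertonDyer.Rank1Residual.Additive

/-! ### §6 Λ-algebra at `T = 0` (rank zero): the constant coefficient of `fE` -/

namespace TameBranchExtraZeros

section LambdaZero

variable {p : ℕ} [hp : Fact p.Prime]

/-- **THE EXTRA ZEROS' CONTRIBUTION AT `T = 0` (Λ-algebra).** `g = fE·h` in `Λ`, `ι g = p^k·B` with
`‖[Tʲ]B‖ ≤ p^c` for all `j` and `B(0) ≠ 0`. Then `fE(0) ≠ 0` and **`v_p(fE(0)) ≤ μ(fE) + v_p(B(0)) + c`**;
if `B` attains its bound, **`=` iff `λ(fE) = λ(g)`**. [cite: Washington1997, §7.1] -/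
theorem valuation_constantCoeff_le {fE h g : IwasawaAlgebra p} (hfac : g = fE * h) {k c : ℕ}
    {B : PowerSeries ℚ_[p]} (hι : iwasawaToPowerSeries p g = PowerSeries.C ((p : ℚ_[p]) ^ k) * B)
    (hbd : ∀ j : ℕ, ‖PowerSeries.coeff j B‖ ≤ (p : ℝ) ^ c) (hB0 : PowerSeries.constantCoeff B ≠ 0) :
    ((PowerSeries.constantCoeff fE : ℤ_[p]) : ℚ_[p]) ≠ 0 ∧
      (((PowerSeries.constantCoeff fE : ℤ_[p]) : ℚ_[p])).valuation ≤
        mu fE + (PowerSeries.constantCoeff B).valuation + c ∧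
      ∀ n : ℕ, ‖PowerSeries.coeff n B‖ = (p : ℝ) ^ c →
        ((((PowerSeries.constantCoeff fE : ℤ_[p]) : ℚ_[p])).valuation =
          mu fE + (PowerSeries.constantCoeff B).valuation + c ↔ lam fE = lam g) := by
  have hpQ : (p : ℚ_[p]) ≠ 0 := Nat.cast_ne_zero.mpr hp.out.ne_zero
  have h0g : PowerSeries.constantCoeff g = PowerSeries.constantCoeff fE * PowerSeries.constantCoeff h := by
    rw [hfac, map_mul]
  have hcoef : ((PowerSeries.constantCoeff g : ℤ_[p]) : ℚ_[p]) =
      (p : ℚ_[p]) ^ k * PowerSeries.constantCoeff B := by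
    rw [← constantCoeff_iwasawaToPowerSeries p g, hι, map_mul, PowerSeries.constantCoeff_C]
  have hg0 : ((PowerSeries.constantCoeff g : ℤ_[p]) : ℚ_[p]) ≠ 0 := by
    rw [hcoef]; exact mul_ne_zero (pow_ne_zero _ hpQ) hB0
  have hg : g ≠ 0 := by
    intro h0; apply hg0; rw [h0]; simp
  have hfE : fE ≠ 0 := by intro h0; apply hg; rw [hfac, h0, zero_mul]
  have hh : h ≠ 0 := by intro h0; apply hg; rw [hfac, h0, mul_zero]
  have hprod : ((PowerSeries.constantCoeff g : ℤ_[p]) : ℚ_[p]) =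
      ((PowerSeries.constantCoeff fE : ℤ_[p]) : ℚ_[p]) *
        ((PowerSeries.constantCoeff h : ℤ_[p]) : ℚ_[p]) := by
    rw [h0g]; push_cast; rfl
  have hf0 : ((PowerSeries.constantCoeff fE : ℤ_[p]) : ℚ_[p]) ≠ 0 := by
    intro e; apply hg0; rw [hprod, e, zero_mul]
  have hh0 : ((PowerSeries.constantCoeff h : ℤ_[p]) : ℚ_[p]) ≠ 0 := by
    intro e; apply hg0; rw [hprod, e, mul_zero]
  have hv0 : (((PowerSeries.constantCoeff fE : ℤ_[p]) : ℚ_[p])).valuation +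
      ((PowerSeries.constantCoeff h : ℤ_[p]) : ℚ_[p]).valuation =
        k + (PowerSeries.constantCoeff B).valuation := by
    rw [← Padic.valuation_mul hf0 hh0, ← hprod, hcoef, Padic.valuation_mul (pow_ne_zero _ hpQ) hB0,
      Padic.valuation_pow, Padic.valuation_p, mul_one]
  have hk : k ≤ mu g + c := le_mu_add_of_iota_eq hg hι hbd
  have hμ : mu g = mu fE + mu h := by rw [hfac]; exact mu_mul hfE hh
  have hlam : lam g = lam fE + lam h := by rw [hfac]; exact lam_mul hfE hh
  obtain ⟨hle, hiff⟩ := mu_le_valuation_constantCoeff hh hh0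
  refine ⟨hf0, by omega, fun n hn ↦ ?_⟩
  have hk' : mu g + c = k := mu_add_eq_of_iota_eq hg hι hbd hn
  constructor
  · intro e
    have : (mu h : ℤ) = ((PowerSeries.constantCoeff h : ℤ_[p]) : ℚ_[p]).valuation := by omega
    rw [hlam, hiff.mp this, add_zero]
  · intro e
    have hl0 : lam h = 0 := by omega
    have := hiff.mpr hl0
    omega

end LambdaZero

end TameBranchExtraZeros

/-! ### §7 Rank zero: the leading-term INEQUALITY `ord Ш + ord Reg_p + ord ∏c + ord ℓ ≤ μ + ord_p B(0) + c
+ 2 ord #tors`, EQUALITY iff `λ(fE) = λ_an` -/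

section CoreZero

open TameBranchExtraZeros

variable {W : WeierstrassCurve ℚ} [W.IsElliptic] {p : ℕ} [hp : Fact p.Prime]

/-- **Core at rank zero (per cyclotomic datum).** `rank_ℤ E(ℚ) = 0`, a (B)-datum `Dh`, a cyclotomic dual
datum `D` with `X` torsion and generator `fE`, `g ∈ char_Λ X` with `ι g = p^k·B`, `‖[Tʲ]B‖ ≤ p^c` for all
`j` and `B(0) ≠ 0`. Then Schneider (trivially shaped in rank `0`), `#Ш[p^∞] < ∞`, and with Delbourgo's `ℓ`
**`ord_p #Ш[p^∞] + ord_p Reg_p(E,Dh) + ord_p ∏c + ord_p ℓ ≤ μ(fE) + ord_p B(0) + c + 2 ord_p #E(ℚ)_tors`**;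
and if the FIRST TOP coefficient of `B` sits at `n`, then `λ(fE) ≤ n` and **EQUALITY iff `λ(fE) = n`**.
For `n = 0` (`ord_p B(0) = −c`) this is gen 26's rank-zero identity. [cite: Delbourgo2002, Theorem (B) (p. 40)]
[cite: Washington1997, §7.1] -/
theorem schneider_and_padicVal_le_rankZero_of_iota_eq
    (hr0 : W.mordellWeilRank = 0) {Dh : PAdicHeightData W p} (hBcl : LeadingTermClauses W p Dh)
    {κ : ZpExtension ℚ p} {γ : Field.absoluteGaloisGroup ℚ}
    (hκ : κ.IsCyclotomic) (hγ : κ.IsTopGenerator γ) (hγ' : IsCyclotomicVariable p γ)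
    (D : W.SelmerDualData κ γ) [Module.Finite (IwasawaAlgebra p) D.X] (hX : D.IsTorsion)
    {fE g : IwasawaAlgebra p} (hchar : D.charIdeal = Ideal.span {fE}) (hg : g ∈ D.charIdeal)
    {k c : ℕ} {B : PowerSeries ℚ_[p]}
    (hι : iwasawaToPowerSeries p g = PowerSeries.C ((p : ℚ_[p]) ^ k) * B)
    (hbd : ∀ j : ℕ, ‖PowerSeries.coeff j B‖ ≤ (p : ℝ) ^ c) (hB0 : PowerSeries.constantCoeff B ≠ 0) :
    SchneiderConjecture Dh ∧ Finite (AddCommGroup.primaryComponent W.sha p) ∧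
      ∃ ℓ : ℕ, ℓ ∣ p ^ 2 ∧ (ReductionNonAnomalous W p → ℓ = 1) ∧
        (padicValNat p (Nat.card (AddCommGroup.primaryComponent W.sha p)) : ℤ) +
            (padicRegulator Dh).valuation + padicValNat p W.tamagawaProduct + padicValNat p ℓ ≤
          X1.MuLambda.mu fE + (PowerSeries.constantCoeff B).valuation + c +
            2 * padicValNat p W.torsionOrder ∧
        ∀ n : ℕ, ‖PowerSeries.coeff n B‖ = (p : ℝ) ^ c → (∀ i < n, ‖PowerSeries.coeff i B‖ < (p : ℝ) ^ c) →
          X1.MuLambda.lam fE ≤ n ∧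
          ((padicValNat p (Nat.card (AddCommGroup.primaryComponent W.sha p)) : ℤ) +
              (padicRegulator Dh).valuation + padicValNat p W.tamagawaProduct + padicValNat p ℓ =
            X1.MuLambda.mu fE + (PowerSeries.constantCoeff B).valuation + c +
              2 * padicValNat p W.torsionOrder ↔ X1.MuLambda.lam fE = n) := by
  have hpP : p.Prime := hp.out
  have hpQ : (p : ℚ_[p]) ≠ 0 := Nat.cast_ne_zero.mpr hpP.ne_zero
  -- the factorisation `g = fE · h`
  have hg' := hg
  rw [hchar] at hg'
  obtain ⟨h, hh⟩ := Ideal.mem_span_singleton'.mp hg'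
  have hfac : g = fE * h := by rw [← hh, mul_comm]
  obtain ⟨hf0, hle, hiffn⟩ := valuation_constantCoeff_le hfac hι hbd hB0
  have hg0 : g ≠ 0 := by
    intro h0
    have e : ((PowerSeries.constantCoeff g : ℤ_[p]) : ℚ_[p]) = (p : ℚ_[p]) ^ k * PowerSeries.constantCoeff B := by
      rw [← constantCoeff_iwasawaToPowerSeries p g, hι, map_mul, PowerSeries.constantCoeff_C]
    rw [h0] at e
    simp only [map_zero, PadicInt.coe_zero] at e
    exact (mul_ne_zero (pow_ne_zero _ hpQ) hB0) e.symm
  have hfE0 : fE ≠ 0 := by intro h0; apply hg0; rw [hfac, h0, zero_mul]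
  have hh0 : h ≠ 0 := by intro h0; apply hg0; rw [hfac, h0, mul_zero]
  have hlam_mul : lam g = lam fE + lam h := by rw [hfac]; exact lam_mul hfE0 hh0
  -- `ord_T fE = 0 = rank`
  have hcl := hBcl κ γ hκ hγ hγ' D hX fE hchar
  have hf0Z : PowerSeries.constantCoeff fE ≠ 0 := by
    intro e; apply hf0; rw [e]; simp
  have horder : fE.order = 0 := by
    rw [← Nat.cast_zero (R := ℕ∞), PowerSeries.order_eq_nat]
    refine ⟨by rwa [PowerSeries.coeff_zero_eq_constantCoeff_apply], fun i hi ↦ ?_⟩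
    omega
  have horder' : fE.order = W.mordellWeilRank := by rw [hr0, horder, Nat.cast_zero]
  obtain ⟨hS, hfin⟩ := hcl.2.1.mp horder'
  -- clause 3 of (B) in rank zero
  obtain ⟨u, ℓ, hℓp, hℓ1, heq⟩ := hcl.2.2 hS hfin
  rw [hr0, pow_zero, mul_one, PowerSeries.coeff_zero_eq_constantCoeff_apply] at heq
  have hT0 : W.torsionOrder ≠ 0 := (W.torsionOrder_pos_holds).ne'
  have hTQ : (W.torsionOrder : ℚ_[p]) ≠ 0 := by exact_mod_cast hT0
  have hu0 : ((u : ℤ_[p]) : ℚ_[p]) ≠ 0 := coe_units_ne_zero p u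
  have hℓ0 : ℓ ≠ 0 := by
    rintro rfl
    exact hpP.ne_zero (pow_eq_zero_iff (n := 2) (by norm_num) |>.mp (zero_dvd_iff.mp hℓp))
  have hℓQ : (ℓ : ℚ_[p]) ≠ 0 := by exact_mod_cast hℓ0
  haveI : Finite (AddCommGroup.primaryComponent W.sha p) := hfin
  have hShp0 : (Nat.card (AddCommGroup.primaryComponent W.sha p) : ℚ_[p]) ≠ 0 := by
    exact_mod_cast Nat.card_pos.ne'
  have hRg0 : padicRegulator Dh ≠ 0 := hS
  have hCc0 : (W.tamagawaProduct : ℚ_[p]) ≠ 0 := by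
    exact_mod_cast (W.tamagawaProduct_pos_holds : 0 < W.tamagawaProduct).ne'
  have hL : (((PowerSeries.constantCoeff fE : ℤ_[p]) : ℚ_[p]) * (W.torsionOrder : ℚ_[p]) ^ 2).valuation =
      (((PowerSeries.constantCoeff fE : ℤ_[p]) : ℚ_[p])).valuation +
        2 * (padicValNat p W.torsionOrder : ℤ) := by
    rw [Padic.valuation_mul hf0 (pow_ne_zero 2 hTQ), Padic.valuation_pow, Padic.valuation_natCast]
    push_cast
    ring
  have hR : (((u : ℤ_[p]) : ℚ_[p]) * (ℓ : ℚ_[p]) *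
        ((Nat.card (AddCommGroup.primaryComponent W.sha p) : ℚ_[p]) * padicRegulator Dh *
          (W.tamagawaProduct : ℚ_[p]))).valuation =
      (padicValNat p ℓ : ℤ) +
        ((padicValNat p (Nat.card (AddCommGroup.primaryComponent W.sha p)) : ℤ) +
          (padicRegulator Dh).valuation + padicValNat p W.tamagawaProduct) := by
    rw [Padic.valuation_mul (mul_ne_zero hu0 hℓQ) (mul_ne_zero (mul_ne_zero hShp0 hRg0) hCc0),
      Padic.valuation_mul hu0 hℓQ, valuation_coe_units_eq_zero, zero_add, Padic.valuation_natCast,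
      Padic.valuation_mul (mul_ne_zero hShp0 hRg0) hCc0, Padic.valuation_mul hShp0 hRg0,
      Padic.valuation_natCast, Padic.valuation_natCast]
  have hval := congrArg Padic.valuation heq
  rw [hL, hR] at hval
  refine ⟨hS, hfin, ℓ, hℓp, hℓ1, by linarith, fun n hn hlt ↦ ?_⟩
  have hlamg : lam g = n := lam_eq_of_iota_eq_of_firstTop hg0 hι hbd hn hlt
  refine ⟨by rw [← hlamg, hlam_mul]; exact Nat.le_add_right _ _, ?_⟩
  rw [← hlamg, ← hiffn n hn]
  constructor
  · intro e; linarith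
  · intro e; linarith

end CoreZero

/-! ### §8 Rank zero, every defect: the typed Kato half + ANY tuple — `B(0) = α⁻¹·[0]⁺_f` -/

section EveryDefectZero

open TameBranchExtraZeros

variable {W : WeierstrassCurve ℚ} [W.IsElliptic] [W.IsGloballyMinimal] {p : ℕ} [hp : Fact p.Prime]
  {N : ℕ} [NeZero N] {f : CuspForm (Gamma0 N) 2}

/-- **THE EXTRA ZEROS' CONTRIBUTION AT RANK ZERO, every defect ((M) included).** `p ≠ 2` additive of
type (M) or (G-ord), `TameBranchRatDvdAt W p`, ANY tuple `(f, ε, α, B)` of the package (`orderOf ε =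
tameDefect`, `‖α‖ = 1`, bound `p^c`), `rank_ℤ E(ℚ) = 0`, `[0]⁺_f ≠ 0` and a (B)-datum `Dh`. Then for every
cyclotomic dual datum with generator `fE`: `#Ш[p^∞] < ∞` and
**`ord_p #Ш[p^∞] + ord_p Reg_p(E,Dh) + ord_p ∏c + ord_p ℓ ≤ μ(fE) + ord_p[0]⁺_f + c + 2 ord_p #E(ℚ)_tors`**
(`B(0) = α⁻¹·[0]⁺_f`, `‖α‖ = 1`); and if `B` has its FIRST TOP at `n` (`= λ_an`): `λ(fE) ≤ n` and
**EQUALITY iff `λ(fE) = n`**. The INEQUALITY needs no twisted value at all; for `ord_p[0]⁺_f = −c`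
(`n = 0`) it is gen 26's identity. [cite: Delbourgo2002, Theorem (A), (B), (C) (p. 40)]
[cite: Washington1997, §7.1] -/
theorem schneider_and_padicVal_le_rankZero_of_tameBranchRatDvdAt (hT : TameBranchRatDvdAt W p)
    {ε : DirichletCharacter ℂ_[p] p} {α : ℚ_[p]} {B : PowerSeries ℚ_[p]}
    (hp2 : p ≠ 2) (hadd : Addv W p) (hloc : PotMult W p ∨ TypeGOrd W p)
    (hf : IsNewformOf W f) (hε : orderOf ε = tameDefect W p) (hα : ‖α‖ = 1)
    (hB : IsTameBranchOf f p ε α B) {c : ℕ} (hbd : ∀ j : ℕ, ‖PowerSeries.coeff j B‖ ≤ (p : ℝ) ^ c)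
    (h0 : ratPlusSymbol f 0 ≠ 0)
    (hr0 : W.mordellWeilRank = 0) {Dh : PAdicHeightData W p} (hBcl : LeadingTermClauses W p Dh)
    {κ : ZpExtension ℚ p} {γ : Field.absoluteGaloisGroup ℚ}
    (hκ : κ.IsCyclotomic) (hγ : κ.IsTopGenerator γ) (hγ' : IsCyclotomicVariable p γ)
    (D : W.SelmerDualData κ γ) [Module.Finite (IwasawaAlgebra p) D.X]
    {fE : IwasawaAlgebra p} (hchar : D.charIdeal = Ideal.span {fE}) :
    SchneiderConjecture Dh ∧ Finite (AddCommGroup.primaryComponent W.sha p) ∧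
      ∃ ℓ : ℕ, ℓ ∣ p ^ 2 ∧ (ReductionNonAnomalous W p → ℓ = 1) ∧
        (padicValNat p (Nat.card (AddCommGroup.primaryComponent W.sha p)) : ℤ) +
            (padicRegulator Dh).valuation + padicValNat p W.tamagawaProduct + padicValNat p ℓ ≤
          X1.MuLambda.mu fE + padicValRat p (ratPlusSymbol f 0) + c + 2 * padicValNat p W.torsionOrder ∧
        ∀ n : ℕ, ‖PowerSeries.coeff n B‖ = (p : ℝ) ^ c → (∀ i < n, ‖PowerSeries.coeff i B‖ < (p : ℝ) ^ c) →
          X1.MuLambda.lam fE ≤ n ∧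
          ((padicValNat p (Nat.card (AddCommGroup.primaryComponent W.sha p)) : ℤ) +
              (padicRegulator Dh).valuation + padicValNat p W.tamagawaProduct + padicValNat p ℓ =
            X1.MuLambda.mu fE + padicValRat p (ratPlusSymbol f 0) + c + 2 * padicValNat p W.torsionOrder ↔
            X1.MuLambda.lam fE = n) := by
  obtain ⟨hX, g, hg, k, hι⟩ := hT ε α B hp2 hadd hloc hκ hγ hγ' hf hε hα hB D
  have h0Q : ((ratPlusSymbol f 0 : ℚ) : ℚ_[p]) ≠ 0 := by exact_mod_cast h0
  have hα0 : α ≠ 0 := by intro e; rw [e, norm_zero] at hα; exact zero_ne_one hα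
  have hB0' : PowerSeries.constantCoeff B = α⁻¹ * ((ratPlusSymbol f 0 : ℚ) : ℚ_[p]) := hB.constantCoeff
  have hB0 : PowerSeries.constantCoeff B ≠ 0 := by
    rw [hB0']; exact mul_ne_zero (inv_ne_zero hα0) h0Q
  have hvB : (PowerSeries.constantCoeff B).valuation = padicValRat p (ratPlusSymbol f 0) := by
    have hαv : (α⁻¹).valuation = 0 := by
      have h1 : ‖α⁻¹‖ = (p : ℝ) ^ (0 : ℕ) := by rw [norm_inv, hα, inv_one, pow_zero]
      have := (norm_eq_pow_iff_valuation_eq (inv_ne_zero hα0) 0).mp h1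
      simpa using this
    rw [hB0', Padic.valuation_mul (inv_ne_zero hα0) h0Q, hαv, zero_add, Padic.valuation_ratCast]
  have h := schneider_and_padicVal_le_rankZero_of_iota_eq hr0 hBcl hκ hγ hγ' D hX hchar hg hι hbd hB0
  rw [hvB] at h
  exact h

end EveryDefectZero

end Summit.BirchSwinnertonDyer.Rank1Residual.Additive

end
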